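import Literature.Computability.Cryptography.RegevReductionFloorGaussianSampler
import Literature.Computability.Cryptography.CoinBlockLaws
import HarnessLib

/-!
# Regev 2009, §3.2.1 — the block data of the `CVP_q` machine READ OFF A COIN STRING: exact laws

Fifth module of the Part-3 first formalisation of Regev's worst-case-to-average-case reduction
(`RegevReductionCVPqSplit` → `…Stability` → `…SamplerSplit` → `…FloorGaussianSampler` → this file).
HONEST FRAMING: the value of this file is a THEOREM about a KNOWN reduction (Regev 2009) — exact
distributional identities for the classical randomness of the `CVP_q` machine — NOT progress on any
summit and it breaks nothing. No new named fact is introduced (axiom debt 0); every declaration is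
proved from the standard axioms.

## What is here

The residual named fact `regev2009_lemma_3_11_cvpqPlumbing` (A_plumb, `…SamplerSplit`) asks for a
uniform quantum circuit family whose output event is dominated by the conditional experiment
`condExpS = condExpG (shiftLawBits …) (sampLaw samp pc …) (sampLaw samp pc …) …` of
`RegevReductionCVPqStability`: `(K_g+1)·J` independent blocks, block `j` = (a uniform shift `s` read off
`ℓU`-bit chunks, `m` coarse LWE-like samples and `N_V` fine verification samples manufactured from the
batch vectors with integer noise drawn by the string sampler `samp` on its own coins), each block's coarse
samples shifted by `s` and handed to the oracle, the answers post-processed by `firstAcceptedK`.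

This file isolates and PROVES the classical-randomness heart of that machine, exactly (no statistical
slack):

* `shiftOfBits`, `noiseOfBits`, `blockOfWords` / `blockOfBits`, `blocksOfBits` — the DETERMINISTIC
  functions `List Bool → data` by which the machine reads the shift, the noise values, one block and all
  blocks off a coin string (chunking by `chunk`, the tree's coin-slicing primitive);
* `uniformVector_map_shiftOfBits : U.map shiftOfBits = shiftLawBits n q ℓU`,
  `uniformVector_map_noiseOfBits : U.map noiseOfBits = sampLaw samp pc M s ℓ`;
* `uniformVector_map_blockOfBits` — **the law of one block read off uniform coins IS `condBlockDataG`
  with the machine's laws** (`shiftLawBits`, `sampLaw` coarse, `sampLaw` fine), for any coin length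
  `C ≥ blockCoins`; `uniformVector_bind_blockOfBits_withAnswer` — the same bound with the oracle kernel;
* `uniformVector_map_blocksOfBits` — all blocks read off ONE uniform string are independent with the
  right block laws; `indepLaw_bind_pi` — independent coordinates post-processed by their own kernels stay
  independent;
* `condExpG_eq_uniformVector_bind` — **normal form**: `condExpG` with the machine's laws = draw one
  uniform coin string, compute every block classically, query the oracle once per block (independently,
  non-adaptively) and post-process by `firstAcceptedK`.

What this buys toward A_plumb: the quantum family `T` it asks for is `CWrap(post) ∘ PolyCopiesIdx(F′)`
with `F′ = CoinPrefix (CWrap (blockOfBits-manufacture, W))`; the per-copy kernel law of `F′` is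
`uniformVector_bind_blockOfBits_withAnswer` read through `CoinPrefix.kernel_eq_bind` /
`CWrap.map_kernel_eq_of_read`, and `PolyCopiesIdx.kernel_map_segments` then yields exactly the
`indepLaw` of `condExpG`. The remaining work (not here) is the `CodeFP` realisation of `blockOfBits` and
the uniform-family bookkeeping.

Sources: Regev 2009 (J. ACM 56(6), art. 34; pages from arXiv:2401.03703): Lemma 3.11 p. 18 (proof:
"choose `s` uniformly … samples from `Ψ_β` can be drawn efficiently"), Lemma 3.7 (verification samples),
§3.2.1; Arora–Barak 2009, Def. 7.1 (probabilistic machines read uniform coin strings), §7.4.1.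
-/

noncomputable section

open MeasureTheory ProbabilityTheory Set Filter
open scoped ENNReal NNReal

namespace Literature.Computability.Cryptography.Regev2009

open Literature.Probability.Distributions Literature.Computability.Complexity
  Literature.Computability.Cryptography.LWE

/-! ### Product-law glue -/

/-- **Independent coordinates, each post-processed by its own kernel, stay independent**:
`⨂ⱼ (Dⱼ >>= κⱼ) = (⨂ⱼ Dⱼ) >>= fun b => ⨂ⱼ κⱼ (bⱼ)`. [folklore] -/
theorem indepLaw_bind_pi {α β : Type} : ∀ (k : ℕ) (D : Fin k → PMF α) (κ : Fin k → α → PMF β),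
    indepLaw k (fun j => (D j).bind (κ j)) = (indepLaw k D).bind fun b => indepLaw k fun j => κ j (b j)
  | 0, D, κ => by
    rw [indepLaw_zero, indepLaw_zero, PMF.pure_bind, indepLaw_zero]
  | k + 1, D, κ => by
    rw [indepLaw_succ, indepLaw_succ, PMF.bind_bind, PMF.bind_bind]
    refine congrArg ((D 0).bind ·) (funext fun d => ?_)
    rw [PMF.bind_map, indepLaw_bind_pi k (fun j => D j.succ) (fun j => κ j.succ)]
    simp_rw [PMF.map_bind]
    rw [PMF.bind_comm]
    refine congrArg ((indepLaw k fun j => D j.succ).bind ·) (funext fun b => ?_)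
    simp only [Function.comp_apply, indepLaw_succ, Fin.cons_zero, Fin.cons_succ]

/-! ### What the machine reads off its coins -/

section Words

/-- **The shift `s ∈ ℤ_qⁿ` read off a coin string**: coordinate `i` is the binary value of the `i`-th
chunk of width `ℓ`, reduced mod `q` (`chunkVal`). [cite: RegevLWE2009, Lemma 3.11 (proof: "choose
`s` uniformly"); AroraBarak2009, Def. 7.1] -/
def shiftOfBits (n q ℓ : ℕ) (r : List Bool) : Fin n → ZMod q := fun i => chunkVal ℓ q r i

/-- **One integer noise value read off a coin word** by the string function `samp` on the parameter
string `⟨M, ⟨s, 1^ℓ⟩⟩` (`sampParams`) and the word, decoded by `decodeIntD`. [cite: RegevLWE2009,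
Lemma 3.11 (proof: "samples from `Ψ_β` can be drawn efficiently")] -/
def noiseOfBits (samp : List Bool → List Bool) (M : ℕ) (s : ℚ) (ℓ : ℕ) (r : List Bool) : ℤ :=
  decodeIntD (samp (boolPair (sampParams M s ℓ) r))

/-- The number of coins `samp` is given on the parameters `(M, s, ℓ)`: `p_c(|⟨M, ⟨s, 1^ℓ⟩⟩|)`.
[cite: AroraBarak2009, Def. 7.1] -/
def coinLen (pc : Polynomial ℕ) (M : ℕ) (s : ℚ) (ℓ : ℕ) : ℕ := pc.eval (sampParams M s ℓ).length

/-- **The law of one noise value read off a uniform word of the right length IS `sampLaw`.**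
[cite: AroraBarak2009, Def. 7.1] -/
theorem uniformVector_map_noiseOfBits (samp : List Bool → List Bool) (pc : Polynomial ℕ) (M : ℕ) (s : ℚ)
    (ℓ : ℕ) :
    (PMF.uniformOfFintype (List.Vector Bool (coinLen pc M s ℓ))).map
        (fun x => noiseOfBits samp M s ℓ x.toList) = sampLaw samp pc M s ℓ := by
  show _ = (PMF.uniformOfFintype (QReg (coinLen pc M s ℓ))).map
      (fun c => decodeIntD (samp (boolPair (sampParams M s ℓ) (List.ofFn c))))
  rw [← PMF.uniformOfFintype_map_equiv (Equiv.vectorEquivFin Bool (coinLen pc M s ℓ)), PMF.map_comp]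
  refine congrArg (PMF.map · _) (funext fun v => ?_)
  show noiseOfBits samp M s ℓ v.toList = decodeIntD (samp (boolPair _ (List.ofFn v.get)))
  rw [ofFn_get_eq_toList]
  rfl

/-- **The law of the shift read off a uniform string IS `shiftLawBits`** (`n` chunks of width `ℓ`).
[cite: AroraBarak2009, Def. 7.1] -/
theorem uniformVector_map_shiftOfBits (n q ℓ : ℕ) :
    (PMF.uniformOfFintype (List.Vector Bool (ℓ * n))).map (fun x => shiftOfBits n q ℓ x.toList) =
      shiftLawBits n q ℓ := by
  classical
  set gq : List.Vector Bool ℓ → ZMod q := fun x => ((bitsToNat x.toList : ℕ) : ZMod q) with hgq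
  have hfun : (fun x : List.Vector Bool (ℓ * n) => shiftOfBits n q ℓ x.toList) =
      (fun v : Fin n → List.Vector Bool ℓ => fun i => gq (v i)) ∘ chunks ℓ n le_rfl := by
    funext x; funext i; rfl
  rw [hfun, ← PMF.map_comp, uniformVector_map_chunks_eq_indepLaw, indepLaw_map_pi, shiftLawBits]
  refine congrArg (indepLaw n) (funext fun _ => ?_)
  rw [← PMF.uniformOfFintype_map_equiv (Equiv.ofBijective _ (vecNum_bijective ℓ)), PMF.map_comp]
  rfl

end Words

/-! ### One block -/

section Block

variable {E : Type} [NormedAddCommGroup E] {L : Submodule ℤ E} {n : ℕ} (bL : Module.Basis (Fin n) ℤ L)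
  (q K m NV : ℕ)

/-- The coarse manufactured sample from the lattice vector `v` with the integer noise value `i`:
`(L⁻¹v mod q, ⌊(num v + i + N/2)/N⌋ mod q)` — so that `coarseKerG χ N num v = χ.map (coarseOfNoise … v)`.
[cite: RegevLWE2009, Lemma 3.11 (proof, Eq. (10))] -/
def coarseOfNoise (N : ℕ) (num : L → ℤ) (v : L) (i : ℤ) : (Fin n → ZMod q) × ZMod q :=
  (coeffMod bL q v, (((num v + i + (N / 2 : ℕ)) / (N : ℤ) : ℤ) : ZMod q))

/-- The fine manufactured sample (modulus `qK`). [cite: RegevLWE2009, Lemma 3.11 (proof, Eq. (10)) with Lemma 3.7 (proof)] -/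
def fineOfNoise (N : ℕ) (num : L → ℤ) (v : L) (i : ℤ) : (Fin n → ZMod q) × ZMod (q * K) :=
  (coeffMod bL q v, ((((K : ℤ) * num v + i + (N / 2 : ℕ)) / (N : ℤ) : ℤ) : ZMod (q * K)))

/-- `coarseKerG` is the push-forward of the noise law along `coarseOfNoise`. [folklore] -/
theorem coarseKerG_eq_map (χ : PMF ℤ) (N : ℕ) (num : L → ℤ) (v : L) :
    coarseKerG bL q χ N num v = χ.map (coarseOfNoise bL q N num v) := rfl

/-- `fineKerG` is the push-forward of the noise law along `fineOfNoise`. [folklore] -/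
theorem fineKerG_eq_map (χ : PMF ℤ) (N : ℕ) (num : L → ℤ) (v : L) :
    fineKerG bL q K χ N num v = χ.map (fineOfNoise bL q K N num v) := rfl

/-- **The block data read off three coin words** `r₁` (shift: `n` chunks of width `ℓU`), `r₂` (coarse
noise: `m` chunks of width `coinLen pc Mc sc ℓc`, one per coarse sample) and `r₃` (fine noise: `N_V`
chunks of width `coinLen pc Mf sf ℓf`), given the block's lattice vectors `u`, the integer arithmetic
`(N, num)` and the sampler `samp`: `(s, (coarse sample from uᵢ with noise samp(chunk i))ᵢ, (fine …)ᵢ)`.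
[cite: RegevLWE2009, Lemma 3.11 (proof) with Lemma 3.7 (proof)] -/
def blockOfWords (samp : List Bool → List Bool) (pc : Polynomial ℕ) (Mc : ℕ) (sc : ℚ) (ℓc : ℕ) (Mf : ℕ)
    (sf : ℚ) (ℓf ℓU : ℕ) (N : ℕ) (num : L → ℤ) (u : Fin (m + NV) → L) (r₁ r₂ r₃ : List Bool) :
    ((Fin n → ZMod q) × (Fin m → (Fin n → ZMod q) × ZMod q)) × (Fin NV → (Fin n → ZMod q) × ZMod (q * K)) :=
  ((shiftOfBits n q ℓU r₁,
    fun i => coarseOfNoise bL q N num (u (Fin.castAdd NV i))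
      (noiseOfBits samp Mc sc ℓc (chunk (coinLen pc Mc sc ℓc) r₂ i))),
    fun i => fineOfNoise bL q K N num (u (Fin.natAdd m i))
      (noiseOfBits samp Mf sf ℓf (chunk (coinLen pc Mf sf ℓf) r₃ i)))

/-- The number of coins one block consumes: `ℓU·n + coinLen_c·m + coinLen_f·N_V`. [folklore] -/
def blockCoins (pc : Polynomial ℕ) (Mc : ℕ) (sc : ℚ) (ℓc : ℕ) (Mf : ℕ) (sf : ℚ) (ℓf ℓU : ℕ) : ℕ :=
  ℓU * n + coinLen pc Mc sc ℓc * m + coinLen pc Mf sf ℓf * NV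

/-- **The block data READ OFF ONE COIN STRING**: the first `ℓU·n` bits give the shift, the next
`coinLen_c·m` the coarse noise values, the following `coinLen_f·N_V` the fine ones (further bits are
ignored). [cite: RegevLWE2009, Lemma 3.11 (proof) with Lemma 3.7 (proof); AroraBarak2009, Def. 7.1] -/
def blockOfBits (samp : List Bool → List Bool) (pc : Polynomial ℕ) (Mc : ℕ) (sc : ℚ) (ℓc : ℕ) (Mf : ℕ)
    (sf : ℚ) (ℓf ℓU : ℕ) (N : ℕ) (num : L → ℤ) (u : Fin (m + NV) → L) (r : List Bool) :
    ((Fin n → ZMod q) × (Fin m → (Fin n → ZMod q) × ZMod q)) × (Fin NV → (Fin n → ZMod q) × ZMod (q * K)) :=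
  blockOfWords bL q K m NV samp pc Mc sc ℓc Mf sf ℓf ℓU N num u (r.take (ℓU * n))
    ((r.drop (ℓU * n)).take (coinLen pc Mc sc ℓc * m)) (r.drop (ℓU * n + coinLen pc Mc sc ℓc * m))

variable (samp : List Bool → List Bool) (pc : Polynomial ℕ) (Mc : ℕ) (sc : ℚ) (ℓc : ℕ) (Mf : ℕ) (sf : ℚ)
  (ℓf ℓU : ℕ) (N : ℕ) (num : L → ℤ) (u : Fin (m + NV) → L)

/-- `blockOfBits` through the two nested splits `r = (r₁ ++ r₂) ++ r₃`. [folklore] -/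
theorem blockOfBits_eq_split (r : List Bool) :
    blockOfBits bL q K m NV samp pc Mc sc ℓc Mf sf ℓf ℓU N num u r =
      blockOfWords bL q K m NV samp pc Mc sc ℓc Mf sf ℓf ℓU N num u
        ((r.take (ℓU * n + coinLen pc Mc sc ℓc * m)).take (ℓU * n))
        ((r.take (ℓU * n + coinLen pc Mc sc ℓc * m)).drop (ℓU * n))
        (r.drop (ℓU * n + coinLen pc Mc sc ℓc * m)) := by
  rw [List.take_take, min_eq_left (Nat.le_add_right _ _), List.drop_take, Nat.add_sub_cancel_left]
  rfl

/-- **The law of the coarse samples read off a uniform word IS the independent product of the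
`coarseKerG (sampLaw …)`.** [cite: AroraBarak2009, Def. 7.1] -/
theorem uniformVector_map_coarse :
    (PMF.uniformOfFintype (List.Vector Bool (coinLen pc Mc sc ℓc * m))).map
        (fun x => fun i : Fin m => coarseOfNoise bL q N num (u (Fin.castAdd NV i))
          (noiseOfBits samp Mc sc ℓc (chunk (coinLen pc Mc sc ℓc) x.toList i))) =
      indepLaw m fun i => coarseKerG bL q (sampLaw samp pc Mc sc ℓc) N num (u (Fin.castAdd NV i)) := by
  classical
  have hfun : (fun x : List.Vector Bool (coinLen pc Mc sc ℓc * m) => fun i : Fin m =>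
      coarseOfNoise bL q N num (u (Fin.castAdd NV i))
        (noiseOfBits samp Mc sc ℓc (chunk (coinLen pc Mc sc ℓc) x.toList i))) =
      (fun v : Fin m → List.Vector Bool (coinLen pc Mc sc ℓc) => fun i =>
        (coarseOfNoise bL q N num (u (Fin.castAdd NV i)) ∘ fun w => noiseOfBits samp Mc sc ℓc w.toList) (v i)) ∘
        chunks (coinLen pc Mc sc ℓc) m le_rfl := by
    funext x; funext i; rfl
  rw [hfun, ← PMF.map_comp, uniformVector_map_chunks_eq_indepLaw, indepLaw_map_pi]
  refine congrArg (indepLaw m) (funext fun i => ?_)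
  rw [← PMF.map_comp, uniformVector_map_noiseOfBits, coarseKerG_eq_map]

/-- **The law of the fine samples read off a uniform word IS the independent product of the
`fineKerG (sampLaw …)`.** [cite: AroraBarak2009, Def. 7.1] -/
theorem uniformVector_map_fine {C : ℕ} (hC : coinLen pc Mf sf ℓf * NV ≤ C) :
    (PMF.uniformOfFintype (List.Vector Bool C)).map
        (fun x => fun i : Fin NV => fineOfNoise bL q K N num (u (Fin.natAdd m i))
          (noiseOfBits samp Mf sf ℓf (chunk (coinLen pc Mf sf ℓf) x.toList i))) =
      indepLaw NV fun i => fineKerG bL q K (sampLaw samp pc Mf sf ℓf) N num (u (Fin.natAdd m i)) := by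
  classical
  have hfun : (fun x : List.Vector Bool C => fun i : Fin NV => fineOfNoise bL q K N num (u (Fin.natAdd m i))
      (noiseOfBits samp Mf sf ℓf (chunk (coinLen pc Mf sf ℓf) x.toList i))) =
      (fun v : Fin NV → List.Vector Bool (coinLen pc Mf sf ℓf) => fun i =>
        (fineOfNoise bL q K N num (u (Fin.natAdd m i)) ∘ fun w => noiseOfBits samp Mf sf ℓf w.toList) (v i)) ∘
        chunks (coinLen pc Mf sf ℓf) NV hC := by
    funext x; funext i; rfl
  rw [hfun, ← PMF.map_comp, uniformVector_map_chunks_eq_indepLaw, indepLaw_map_pi]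
  refine congrArg (indepLaw NV) (funext fun i => ?_)
  rw [← PMF.map_comp, uniformVector_map_noiseOfBits, fineKerG_eq_map]

/-- Push-forward of a uniform pair of words along a product map. [folklore] -/
theorem uniformVector_prod_map_prodMap {a b : ℕ} {α β : Type} (f : List.Vector Bool a → α)
    (g : List.Vector Bool b → β) :
    (PMF.uniformOfFintype (List.Vector Bool a × List.Vector Bool b)).map (Prod.map f g) =
      prodLaw ((PMF.uniformOfFintype (List.Vector Bool a)).map f)
        ((PMF.uniformOfFintype (List.Vector Bool b)).map g) := by
  rw [← prodLaw_uniformOfFintype, prodLaw_map_prodMap]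

/-- **THE LAW OF ONE BLOCK READ OFF A UNIFORM COIN STRING** of length `C ≥ blockCoins`: it IS the
conditional block data `condBlockDataG` of `RegevReductionCVPqStability.lean` run with the machine's
EXACT sampler laws — the shift law `shiftLawBits n q ℓU`, the coarse noise law `sampLaw samp pc Mc sc ℓc`
and the fine noise law `sampLaw samp pc Mf sf ℓf` (the laws named in A_plumb). [cite: RegevLWE2009,
Lemma 3.11 (proof) with Lemma 3.7 (proof); AroraBarak2009, Def. 7.1] -/
theorem uniformVector_map_blockOfBits {C : ℕ} (hC : blockCoins (n := n) m NV pc Mc sc ℓc Mf sf ℓf ℓU ≤ C) :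
    (PMF.uniformOfFintype (List.Vector Bool C)).map
        (fun r => blockOfBits bL q K m NV samp pc Mc sc ℓc Mf sf ℓf ℓU N num u r.toList) =
      condBlockDataG bL q K m NV (shiftLawBits n q ℓU) (sampLaw samp pc Mc sc ℓc) (sampLaw samp pc Mf sf ℓf)
        N num u := by
  classical
  set LC := coinLen pc Mc sc ℓc with hLC
  set LF := coinLen pc Mf sf ℓf with hLF
  set A := ℓU * n + LC * m with hA
  have hAC : A ≤ C := le_trans (Nat.le_add_right _ _) hC
  have hFC : LF * NV ≤ C - A := by
    have : A + LF * NV ≤ C := hC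
    omega
  have hUA : ℓU * n ≤ A := Nat.le_add_right _ _
  -- the three readers on words
  set Sv : List.Vector Bool (ℓU * n) → (Fin n → ZMod q) := fun w => shiftOfBits n q ℓU w.toList with hSv
  set Cv : List.Vector Bool (A - ℓU * n) → (Fin m → (Fin n → ZMod q) × ZMod q) := fun w i =>
    coarseOfNoise bL q N num (u (Fin.castAdd NV i)) (noiseOfBits samp Mc sc ℓc (chunk LC w.toList i)) with hCv
  set Fv : List.Vector Bool (C - A) → (Fin NV → (Fin n → ZMod q) × ZMod (q * K)) := fun w i =>
    fineOfNoise bL q K N num (u (Fin.natAdd m i)) (noiseOfBits samp Mf sf ℓf (chunk LF w.toList i)) with hFv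
  have hfun : (fun r : List.Vector Bool C => blockOfBits bL q K m NV samp pc Mc sc ℓc Mf sf ℓf ℓU N num u r.toList) =
      Prod.map (Prod.map Sv Cv ∘ vecSplit (ℓU * n) A hUA) Fv ∘ vecSplit A C hAC := by
    funext r
    rw [Function.comp_apply, blockOfBits_eq_split]
    rfl
  rw [hfun, ← PMF.map_comp, uniformVector_map_vecSplit, uniformVector_prod_map_prodMap, ← PMF.map_comp,
    uniformVector_map_vecSplit, uniformVector_prod_map_prodMap, condBlockDataG, hSv,
    uniformVector_map_shiftOfBits, hFv, uniformVector_map_fine bL q K m NV samp pc Mf sf ℓf N num u hFC]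
  congr 2
  have hw : A - ℓU * n = LC * m := by rw [hA]; omega
  -- transport the coarse word length `A - ℓU n = LC m`
  have key : ∀ (W : ℕ) (hW : W = LC * m),
      (PMF.uniformOfFintype (List.Vector Bool W)).map (fun w i =>
        coarseOfNoise bL q N num (u (Fin.castAdd NV i)) (noiseOfBits samp Mc sc ℓc (chunk LC w.toList i))) =
      indepLaw m fun i => coarseKerG bL q (sampLaw samp pc Mc sc ℓc) N num (u (Fin.castAdd NV i)) := by
    rintro W rfl
    exact uniformVector_map_coarse bL q m NV samp pc Mc sc ℓc N num u
  exact key _ hw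

/-- **The block with its oracle answer**: binding the block read off uniform coins with the oracle
kernel `A` on the shifted coarse samples (`withAnswer`) gives `condBlockDataG … >>= withAnswer A` —
one factor of `condExpG`. [cite: RegevLWE2009, Lemma 3.11 (proof)] -/
theorem uniformVector_bind_blockOfBits_withAnswer {C : ℕ}
    (hC : blockCoins (n := n) m NV pc Mc sc ℓc Mf sf ℓf ℓU ≤ C) (Ans : Solver (Fin n) (ZMod q) m) :
    (PMF.uniformOfFintype (List.Vector Bool C)).bind
        (fun r => withAnswer q K m NV Ans (blockOfBits bL q K m NV samp pc Mc sc ℓc Mf sf ℓf ℓU N num u r.toList)) =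
      (condBlockDataG bL q K m NV (shiftLawBits n q ℓU) (sampLaw samp pc Mc sc ℓc) (sampLaw samp pc Mf sf ℓf)
        N num u).bind (withAnswer q K m NV Ans) := by
  rw [← uniformVector_map_blockOfBits bL q K m NV samp pc Mc sc ℓc Mf sf ℓf ℓU N num u hC, PMF.bind_map]
  rfl

end Block

/-! ### All blocks of the experiment -/

section Blocks

variable {E : Type} [NormedAddCommGroup E] {L : Submodule ℤ E} {n : ℕ} (bL : Module.Basis (Fin n) ℤ L)
  (q K m NV Kg J : ℕ) (samp : List Bool → List Bool) (pc : Polynomial ℕ) (Mc : ℕ)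
  (sc : Fin ((Kg + 1) * J) → ℚ) (ℓc : ℕ) (Mf : ℕ) (sf : ℚ) (ℓf ℓU : ℕ) (N : ℕ) (num : L → ℤ)
  (w : Fin ((Kg + 1) * J) → Fin (m + NV) → L)

/-- **All `(K_g+1)·J` blocks read off one coin string**: block `j` reads its data off the `j`-th chunk of
width `B` (any `B` at least every block's `blockCoins`; block `j`'s coarse width parameter is `sc j`,
Lemma 3.7's padded variance at its level). [cite: RegevLWE2009, Lemma 3.11 (proof) with Lemma 3.7 (proof);
AroraBarak2009, Def. 7.1 and §7.4.1] -/
def blocksOfBits (B : ℕ) (r : List Bool) (j : Fin ((Kg + 1) * J)) :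
    ((Fin n → ZMod q) × (Fin m → (Fin n → ZMod q) × ZMod q)) × (Fin NV → (Fin n → ZMod q) × ZMod (q * K)) :=
  blockOfBits bL q K m NV samp pc Mc (sc j) ℓc Mf sf ℓf ℓU N num (w j) (chunk B r j)

/-- **THE LAW OF ALL BLOCKS READ OFF A UNIFORM COIN STRING** of length `C ≥ B·(K_g+1)J`, `B` bounding
every block's consumption: the blocks are INDEPENDENT, block `j` distributed as `condBlockDataG` with the
machine's exact laws (`shiftLawBits`, `sampLaw samp pc Mc (sc j) ℓc`, `sampLaw samp pc Mf sf ℓf`).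
[cite: RegevLWE2009, Lemma 3.11 (proof); AroraBarak2009, §7.4.1] -/
theorem uniformVector_map_blocksOfBits {B C : ℕ}
    (hB : ∀ j, blockCoins (n := n) m NV pc Mc (sc j) ℓc Mf sf ℓf ℓU ≤ B) (hC : B * ((Kg + 1) * J) ≤ C) :
    (PMF.uniformOfFintype (List.Vector Bool C)).map
        (fun r => blocksOfBits bL q K m NV Kg J samp pc Mc sc ℓc Mf sf ℓf ℓU N num w B r.toList) =
      indepLaw ((Kg + 1) * J) fun j =>
        condBlockDataG bL q K m NV (shiftLawBits n q ℓU) (sampLaw samp pc Mc (sc j) ℓc)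
          (sampLaw samp pc Mf sf ℓf) N num (w j) := by
  classical
  have hfun : (fun r : List.Vector Bool C =>
      blocksOfBits bL q K m NV Kg J samp pc Mc sc ℓc Mf sf ℓf ℓU N num w B r.toList) =
      (fun v : Fin ((Kg + 1) * J) → List.Vector Bool B => fun j =>
        (fun x : List.Vector Bool B =>
          blockOfBits bL q K m NV samp pc Mc (sc j) ℓc Mf sf ℓf ℓU N num (w j) x.toList) (v j)) ∘
        chunks B ((Kg + 1) * J) hC := by
    funext r; funext j; rfl
  rw [hfun, ← PMF.map_comp, uniformVector_map_chunks_eq_indepLaw]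
  exact (indepLaw_map_pi _ _ fun j (x : List.Vector Bool B) =>
      blockOfBits bL q K m NV samp pc Mc (sc j) ℓc Mf sf ℓf ℓU N num (w j) x.toList).trans
    (congrArg (indepLaw _) (funext fun j =>
      uniformVector_map_blockOfBits bL q K m NV samp pc Mc (sc j) ℓc Mf sf ℓf ℓU N num (w j) (hB j)))

/-- **`condExpG` WITH THE MACHINE'S LAWS, READ OFF THE COINS**: the whole conditional experiment run with
the exact sampler laws equals — draw ONE uniform coin string, compute every block's data CLASSICALLY
(`blocksOfBits`), query the oracle kernel `A` once per block on the shifted coarse samples (independently,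
non-adaptively), and post-process by `firstAcceptedK`. This is the classical-randomness normal form of
the procedure A_plumb asks a uniform quantum family to realise. [cite: RegevLWE2009, §3.2.1 (Lemma 3.4,
proof: Lemmas 3.7, 3.11); AroraBarak2009, Def. 7.1] -/
theorem condExpG_eq_uniformVector_bind {B C : ℕ}
    (hB : ∀ j, blockCoins (n := n) m NV pc Mc (sc j) ℓc Mf sf ℓf ℓU ≤ B) (hC : B * ((Kg + 1) * J) ≤ C)
    (Ans : Solver (Fin n) (ZMod q) m)
    (Acc : (Fin n → ZMod q) → Set (Fin NV → (Fin n → ZMod q) × ZMod (q * K))) :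
    condExpG bL q K m NV Kg J (shiftLawBits n q ℓU) (fun j => sampLaw samp pc Mc (sc j) ℓc)
        (sampLaw samp pc Mf sf ℓf) N num Ans Acc w =
      (PMF.uniformOfFintype (List.Vector Bool C)).bind fun r =>
        (indepLaw ((Kg + 1) * J) fun j =>
            withAnswer q K m NV Ans (blocksOfBits bL q K m NV Kg J samp pc Mc sc ℓc Mf sf ℓf ℓU N num w B r.toList j)).map
          (firstAcceptedK q K m NV Acc) := by
  rw [condExpG, indepLaw_bind_pi, ← uniformVector_map_blocksOfBits bL q K m NV Kg J samp pc Mc sc ℓc Mf sf ℓf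
    ℓU N num w hB hC, PMF.bind_map, PMF.map_bind]
  rfl

end Blocks

end Literature.Computability.Cryptography.Regev2009

end
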